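import Literature.MathematicalPhysics.QuantumFieldTheory.Balaban1983to89.B9Cor35CinvAtCubeLetters
import Literature.MathematicalPhysics.QuantumFieldTheory.Balaban1983to89.B9Thm34POneUniformBlk

/-!
# `Balaban1983to89.B9Cor35POneAtCubeLetters` — (3.76)–(3.77) p. 405–406 FOR THE CUBE: THEOREM 3.4's `P₁`-CLAUSE AT `U = 1` OVER p33's CUBE GEOMETRY, UNIFORMLY IN THE
# MEMBER AND THE COVER CUBE — r06's `B9Thm34POneUniformBlk.exists_threshold_pOne_uniform_blk` with every `A`-independent binder DISCHARGED at
# `(g, blk, P, blkP, rep) := (geoCK i □, blkCubeY i □, BlkCubeY i □ × ι, Prod.fst, corner section)`, the output inverse IDENTIFIED with the record's `conj b(η⁻⁴C_□(Ṽ_□))`,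
# the section words COLLAPSED, and the four printed remainder words of (3.76) SUMMED to `D_{Ṽ}𝒫_□(Ṽ)D*_{Ṽ} − D₁𝒫_□(1)D*₁`
# (sub-row G-B9-LETTERS, module M5.1b-G «Cor 3.5∕3.6 for the bond-sector cube letter G_□», FILE G-F5c′ = the zeroth-order projection word `P₁`)

T. Bałaban, *Propagators for lattice gauge theories in a background field*, Commun. Math. Phys. **99** (1985) 389–434
[`Balaban1985BackgroundPropagators`, "B9"]; [4] = T. Bałaban, *Propagators and renormalization transformations for lattice gauge
theories. II*, Commun. Math. Phys. **96** (1984) 223–250 [`Balaban1984PropagatorsII`].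

statement-level skeleton of published theorems with citation tags; proofs where landed; nothing here is a claim about the
Yang–Mills mass gap

THE PRINTED LOCUS (verbatim, held `paper:balaban1985-cmp99-background-propagators`, journal page = PDF page + 388; page owner r06).  p. 405 (3.76): *«D_{U′U}R(U′U)D\*_{U′U}
= D_UR(U)D\*_U + (D_{U′U} − D_U)R(U)D\*_U + D_UR(U)(D\*_{U′U} − D\*_U) + (D_{U′U} − D_U)R(U)(D\*_{U′U} − D\*_U) − D_{U′U}P₁(A)D\*_{U′U}»* with `R = I − P` ((3.25) p. 394,
`P = G′Q′*(Q′G′²Q′*)⁻¹Q′G′`) and `P(U′U) = P(U) + P₁(A)` ((3.68) p. 403); p. 406 (3.77): *«Using Lemma 2.1 [4], we can estimate easily the above expression and we get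
|(P₁(A)f)(b)| ≦ O(1)α₁(Lʲη)⁻²e^{−(1∕2)δ₀d(y,y′)}|f| (3.77)»*; Cor. 3.5 p. 407 (*«with … U = 1, these theorems are proved in [4]»*); Cor. 3.6 p. 408 l. 1–10 (the operators of
the sequence `{Ω_n(□)}` after the gauge transformation (3.35)); p. 409 l. 2–5 (`C_□(U) = (Q′(U)G′²_□(U)Q′*(U))⁻¹`).

WHY THIS FILE (cell `lit-balaban`; module M5.1b-G, p38 g43; road agreed with r06 g68 ∕ lead g33, HOME INBOX 2026-08-28T17:44:59Z).  G-F5′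
(`B9Cor35GAtCubeLettersFirstOrder.cor35_G_cube_of_pieces₂`, p653979) assembles Theorem 3.4's G-clause for the bond-sector cube letter `G_□ = Δ_{a,□}⁻¹` from a splitting
`projPieceK = P⁰ + Σ_ν P¹_ν·DK ν + PP` of the projection piece `D₁R_□(1)D*₁ − D_ṼR_□(Ṽ)D*_Ṽ`: the first-order part `D₁D*₁ − D_ṼD*_Ṽ` is G-F5b (`B9Eq375GradDivSplitY`,
`B9Ineq375GradDivBoundsY`), and `PP = D_Ṽ𝒫_□(Ṽ)D*_Ṽ − D₁𝒫_□(1)D*₁` (`𝒫_□ = G′_□Q′_□*C_□Q′_□G′_□`, `R_□ = I − 𝒫_□`) is print's (3.76)–(3.77) remainder — the NON-LOCAL,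
ZEROTH-ORDER word.  r06's R-Ker-4 FILE 2 `exists_threshold_pOne_uniform_blk` delivers exactly its (3.77) majorant `K·α₁·(Lʲη)⁻²·e^{−(δ₀∕5)d}` for the four printed words of
(3.76), on a general block carrier; THIS FILE instantiates it at the cube (binders discharged as in p21's `cor35_Cinv_cube` and p33's `cor35_Gp_cube`), identifies the engine's
letters with the record's (`G′_□(Ṽ_□)`, `C_□(Ṽ_□)` by uniqueness of two-sided inverses — p21 §1), collapses the section words (`rep* ∘ rep_! = id`), and sums the four words.
The def-Y dictionary (`gradLin ∕ divLin ∕ UboxY` ↔ `gradY ∕ divY`, carrier relabel `FBondY × ι ≃ (Fin(d+1) × SiteY) × ι`) and the feed into `cor35_G_cube_of_pieces₂` are the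
next files.

WHAT THIS FILE PROVES (THEOREMS; 0 `def … : Prop`, 0 sorry, no `def`).
* §1 `pOp_sec_eq` (the `P`-word in section letters IS the `P`-word on the block carrier, `rep` injective), `four_words_eq` (the (3.76) algebra:
  `E𝒫D*₁ + D₁𝒫E* + E𝒫E* + D_Ṽ(𝒫′ − 𝒫)D*_Ṽ = D_Ṽ𝒫′D*_Ṽ − D₁𝒫D*₁`, `E = D_Ṽ − D₁`), `rep_cube` facts (`blkCubeY ∘ corner = id`, injective),
  `prodCfg_one_chartA_eq_UboxY_locCfgY` (`U′·1 = Ṽ_□` on the chart).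
* §2 ★★★ `cor35_POne_cube` — there are `δ, M₀, T₀, N₀`, `a₁ > 0` and `K ≧ 0` (functions of `d, L, M₂, C_q` only) such that for every member above the thresholds, every cover
  cube, every transporter letter with `par 1 = 1`, every `0 ≦ α₁ ≦ a₁` and every vector potential `A` whose cut-off `χ̃_□A` obeys the seven blockwise (3.37)∕(3.59) readings of
  `cor35_Gp_cube` and the two pointwise (3.59) sizes of `cor35_Cinv_cube`:
  `conĵ(D^η_Ṽ) ∘ 𝒫̂_□(Ṽ_□) ∘ conĵ(D^η*_Ṽ) − conĵ(D^η_1) ∘ 𝒫̂_□(1) ∘ conĵ(D^η*_1) ≺ K·α₁·ℓ(a)⁻²·e^{−δd(a,a′)}` over `(toB6 (geoCK i □) Rr H, q ↦ blkCubeY(q.1.2))`, where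
  `𝒫̂_□(V) = conj b(η²G′_□(V)) ∘ conĵ Q′_□*(V) ∘ conj b(η⁻⁴C_□(V)) ∘ conĵ Q′_□(V) ∘ conj b(η²G′_□(V))` (r06's letters `gradLin`, `divLin` at `c = η⁻¹`, `UboxY Ṽ_□`).

HONEST SCOPE.  Assembly over landed modules; r06's engine BY NAME; the nine readings∕sizes of `χ̃_□A` are DISPLAYED HYPOTHESES (discharged from the (3.35) cube datum by p33's
`B9Cor36GpCubeIsUnit.isUnit_and_localInverse_laws` ∕ `B9Cor36CinvCubeAtLocCfg`, not repeated here); thresholds displayed; `‖1‖ ≦ 1`.  Count-neutral; no summit ∕ sub-problem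
statement is proved; nothing continuum ∕ OS ∕ mass-gap ∕ Clay; NOT a node discharge; YM mass gap NOT proved by any of this (Track A conditional rung).  No `sorry`, no `axiom`,
no `… : Prop` fact, no `instance`, no `notation`.  NEW file; nothing landed is modified.  Cell `lit-balaban`, seat `lit-balaban-p38` gen 43, 2026-08-28;
`--supports stmt-QuantumFields-19200`.  Net new unproved facts: 0.

RELATED IN THE TREE, NOT DUPLICATED (searched 2026-08-28): r06 `B9Thm34POneUniformBlk.exists_threshold_pOne_uniform_blk` (the engine, USED BY NAME), `B9Thm34GCoarseBlk` (its
G-clause twin on a coarse carrier; the section-collapse pattern mirrored), p21 `B9Cor35CinvAtCubeLetters` (C-clause twin; §1 identifications USED), p33 `B9Cor35GpAtCubeLetters`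
(G′ twin; word laws USED), `B9Cor36GpCubeIsUnit.DpK_sub_conj_vPrimeConc`, `B6RandomWalkSection` (`secRes_secExt_apply`), `B6Geom246MultiLevelBoxL0` (`corner`, `blkOf_corner`).
-/

noncomputable section

namespace Literature.MathematicalPhysics.QuantumFieldTheory.Balaban1983to89.B9Cor35POneAtCubeLetters

open B6KLevelCensusIndexV1 (KIdx kGeo)
open B6Cover236MultiLevelBlocks (cubes)
open B6RandomWalk (HasMajorant BlockSupp hasMajorant_mono Triangle254 Ineq261 c1_nonneg)
open B6RandomWalkHom (HasMajorantHom hasMajorantHom_mono)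
open B6RandomWalkSection (secExt secRes secConj secConj_def secRes_secExt_apply)
open B6Geom246MultiLevelBoxL0 (blkOf corner corner_mem blkOf_corner)
open B9Thm34Ext (toB6)
open B9Ineq347 (ScaleTransfer)
open B9Eq352DivFormLetters (conj)
open B9Eq352GradLetters (diffLetter)
open B9Eq360Vprime (gPrimeExtEnd pPrime pOp)
open B9Eq360VprimeLetters (vPrimeConc)
open B9Eq39Adjoint (covD covDstar prodCfg)
open B9Eq352DivForm (tauB)
open B9Eq376POneLetters (conjHom conjHom_comp conjHom_eq_conj gradLin divLin)
open B9Thm34POneUniformBlk (exists_threshold_pOne_uniform_blk)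
open B9Thm31CubeLocalFlat (thm32_cubeW_flat)
open B9CubeLettersOpsL0 (cubeFamY oddMh GpCubeY deltaPrimeACubeY)
open B9CubeLettersBondOpsL0 (BlkCubeY qpKc qpsKc QpCubeY QpsCubeY XCubeY XinvCubeY)
open B9Eq360DeltaPrimeAY (AfldY chartA UboxY_mulY_fluct)
open B9Eq360DeltaPrimeACubeY (blkCubeY kQCubeY sQCubeY kFCubeY sFCubeY)
open B9CubeGeometryInputs (geoCK geoCK_len geoCK_eta geoCK_eta_pos geoCK_len_pos geoCK_eta_le_len geoCK_dist_axioms stencil_geoCK geoCK_site_nonempty hST_geoCK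
  exists_h261_geoCK N1 RM1)
open B9Cor35GpCubeInputsAtOne (GpK DpK wK cfunK wK_nonneg card_block_mul_wK_le norm_kQCubeY_one_le norm_sQCubeY_one_le abs_cfunK_le eta_ne_zero
  h342_1_cube h342_2_cube_inl h342_2_cube_inr h342_3_cube_inl h342_3_cube_inr)
open B9Cor35GpAtCubeLetters (cor35_Gp_cube thm31_cube_allOrientations hasMajorant_geomT_of_toB6)
open B9Cor35CinvAtCubeLetters (eq_conj_GpCubeY_of_laws conjHom_Qp_conj_sq_Qps_eq eq_conj_XinvCubeY_of_laws kernel_rate_mono)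
open B9Cor36CutoffField337 (cutFldY UboxY_one)
open B9Cor36CubeCutoffs (chiTY locCfgY)
open B9Cor36GpCubeIsUnit (DpK_sub_conj_vPrimeConc)
open B9Cor36CubeSandwichQ (hasMajorantHom_conjHom_QpCubeY hasMajorantHom_conjHom_QpsCubeY)
open B9Cor36CubeCinvAtOne (CinvK hLinv_cube h348_cube xinvKc_abs_le_of_kernel_bound)
open B9Eq357CubeQpDiffMajorant (conjHom_restrictScalars_eq_add hasMajorantHom_conjHom_QpCubeY_sub hasMajorantHom_conjHom_QpsCubeY_sub)
open Node00 (SiteY CfgY SiteParY toKT shiftY UboxY)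

variable {d ℓ : ℕ} {hd : 1 ≤ d + 1} {hL : Odd (ℓ + 1) ∧ 1 < ℓ + 1} {b₀ b₁ : ℝ}
variable {𝔸 : Type} [NormedRing 𝔸] [NormedAlgebra ℂ 𝔸] [CompleteSpace 𝔸]
variable {ι : Type} [Fintype ι] (b : Module.Basis ι ℝ 𝔸)

/-! ## §1 The section words collapse; the four words of (3.76) sum; the corner section of the cube blocks; `U′·1 = Ṽ_□` -/

section Words

variable {X P : Type}

/-- ★ **THE `P`-WORD IN SECTION LETTERS IS THE `P`-WORD ON THE BLOCK CARRIER**: for an injective section `rep` (`rep* ∘ rep_! = id`),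
`G·(Qs ∘ rep*)·(rep_! C rep*)·(rep_! ∘ Q)·G = G ∘ Qs ∘ C ∘ Q ∘ G`. [cite: Balaban1985BackgroundPropagators, (3.25) p.394, (3.68) p.403; Balaban1984PropagatorsII, (2.51)–(2.52) p.232] -/
theorem pOp_sec_eq {rep : P → X} (hinj : Function.Injective rep) (G : Module.End ℝ (X → ℝ)) (Qs : (P → ℝ) →ₗ[ℝ] (X → ℝ)) (C : Module.End ℝ (P → ℝ))
    (Q : (X → ℝ) →ₗ[ℝ] (P → ℝ)) :
    pOp G (Qs ∘ₗ secRes rep) (secConj rep C) (secExt rep ∘ₗ Q) = G ∘ₗ Qs ∘ₗ C ∘ₗ Q ∘ₗ G := by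
  refine LinearMap.ext fun F => ?_
  simp only [pOp, Module.End.mul_apply, LinearMap.comp_apply, secConj_def, secRes_secExt_apply hinj]

/-- ★ **THE FOUR WORDS OF (3.76) SUM**: with `E = a − a₁`, `E* = a′ − a′₁` and `𝒫′ = 𝒫(Ṽ) − 𝒫(1)` ((3.68)),
`E𝒫a′₁ + a₁𝒫E* + E𝒫E* + a(𝒫(Ṽ) − 𝒫)a′ = a𝒫(Ṽ)a′ − a₁𝒫a′₁` — print's (3.76) read backwards. [cite: Balaban1985BackgroundPropagators, (3.76) p.405, (3.68) p.403] -/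
theorem four_words_eq {Y : Type} (a a₁ : (X → ℝ) →ₗ[ℝ] (Y → ℝ)) (a' a'₁ : (Y → ℝ) →ₗ[ℝ] (X → ℝ)) (Pw Pw' : Module.End ℝ (X → ℝ)) :
    (a - a₁) ∘ₗ Pw ∘ₗ a'₁ + a₁ ∘ₗ Pw ∘ₗ (a' - a'₁) + (a - a₁) ∘ₗ Pw ∘ₗ (a' - a'₁) + a ∘ₗ (Pw' - Pw) ∘ₗ a' = a ∘ₗ Pw' ∘ₗ a' - a₁ ∘ₗ Pw ∘ₗ a'₁ := by
  simp only [LinearMap.sub_comp, LinearMap.comp_sub]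
  abel

end Words

section Cube

variable (i : KIdx d ℓ hd hL b₀ b₁) (c : ↥(cubes (toKT i).D.toDomains))

omit [NormedRing 𝔸] [NormedAlgebra ℂ 𝔸] [CompleteSpace 𝔸] [Fintype ι] in
/-- the CORNER SECTION of the cube blocks is block-compatible: the block of the corner site of `y` is `y`.
[cite: Balaban1984PropagatorsII, (2.45) p.231, (2.1) p.224, bookkeeping] -/
theorem blkCubeY_corner (y : BlkCubeY i c) :
    blkCubeY i c ⟨corner (cubeFamY i c).toDomains y, corner_mem (cubeFamY i c).toDomains y⟩ = y :=
  blkOf_corner (cubeFamY i c).toDomains y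

omit [NormedRing 𝔸] [NormedAlgebra ℂ 𝔸] [CompleteSpace 𝔸] [Fintype ι] in
/-- the corner section `(y, j) ↦ (corner y, j)` of `BlkCubeY i □ × ι` into `SiteY i × ι` is injective. [cite: Balaban1984PropagatorsII, (2.45) p.231, bookkeeping] -/
theorem rep_corner_injective :
    Function.Injective (fun p : BlkCubeY i c × ι =>
      ((⟨corner (cubeFamY i c).toDomains p.1, corner_mem (cubeFamY i c).toDomains p.1⟩ : SiteY i), p.2)) := by
  intro p q h
  simp only [Prod.mk.injEq] at h
  obtain ⟨h1, h2⟩ := h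
  refine Prod.ext ?_ h2
  rw [← blkCubeY_corner i c p.1, ← blkCubeY_corner i c q.1]
  exact congrArg (blkCubeY i c) h1

/-- ON THE CHART, `U′·1` with `U′ = e^{iηχ̃_□A}` IS `Ṽ_□ = locCfgY i □ η A` read through `UboxY`. [cite: Balaban1985BackgroundPropagators, Cor. 3.6 p.408, (3.50) p.400, dictionary] -/
theorem prodCfg_one_chartA_eq_UboxY_locCfgY (A : AfldY 𝔸 i) :
    prodCfg (fun _ _ => (1 : 𝔸ˣ)) (geoCK i c).eta (chartA i (cutFldY i (chiTY i c) A)) = UboxY i (locCfgY i c (kGeo i).eta A) := by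
  rw [geoCK_eta, locCfgY, UboxY_mulY_fluct, UboxY_one]

end Cube

/-! ## §2 ★★★ (3.77) for the cube: the `P₁` remainder of the projection piece -/

section Main

set_option maxRecDepth 16384 in
/-- ★★★ **(3.76)–(3.77) FOR THE CUBE LETTERS — THEOREM 3.4's `P₁`-CLAUSE AT `U = 1` OVER THE CUBE SEQUENCE, UNIFORMLY IN THE MEMBER AND THE COVER CUBE, SUMMED**: there are a
rate `δ > 0`, thresholds `M₀, T₀, N₀`, `a₁ > 0` and `K ≧ 0` — functions of `d, L`, the basis datum `M₂` and the (3.59) size `C_q` only — such that for every member above the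
thresholds, every cover cube `□`, every transporter letter with `par 1 = 1`, every `0 ≦ α₁ ≦ a₁` and every vector potential `A` whose cut-off `χ̃_□A` (chart `chartA`) obeys the
blockwise (3.37) bounds over the cube blocks with the (3.59) kernels of size `C_q·α₁` and whose (3.57) letters obey the two pointwise (3.59) sizes `C_q·α₁·Q̃′|λ|`:
the realified `D_Ṽ𝒫_□(Ṽ_□)D*_Ṽ − D₁𝒫_□(1)D*₁` (r06's letters: `gradLin`∕`divLin` at `c = η⁻¹`, `𝒫̂_□(V) = conj b(η²G′_□(V))∘conĵQ′_□*(V)∘conj b(η⁻⁴C_□(V))∘conĵQ′_□(V)∘conj b(η²G′_□(V))`)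
has the block majorant `K·α₁·ℓ(a)⁻²·e^{−δd(a,a′)}` over `(toB6 (geoCK i □) Rr H, q ↦ blkCubeY(q.1.2))`.
[cite: Balaban1985BackgroundPropagators, (3.76)–(3.77) pp.405–406, (3.68) p.403, (3.25) p.394, Cor. 3.5 p.407, Cor. 3.6 p.408, Thm 3.4 p.400, Thm 3.2 (3.48) p.398, p.409 l.2–5; Balaban1984PropagatorsII, Lemma 2.1 p.234, (2.51)–(2.52) p.232] -/
theorem cor35_POne_cube [DecidableEq ι] (d ℓ : ℕ) (hℓ : 1 ≤ ℓ) (Cq M₂ : ℝ) (hCq : 0 ≤ Cq) (hM₂ : 0 ≤ M₂) (hrepr : ∀ (v : 𝔸) (j : ι), |b.repr v j| ≤ M₂ * ‖v‖)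
    (h1 : ‖(1 : 𝔸)‖ ≤ 1) :
    ∃ δ M₀ T₀ : ℝ, ∃ N₀ : ℕ, 0 < δ ∧ ∃ a₁ : ℝ, 0 < a₁ ∧ ∃ K : ℝ, 0 ≤ K ∧
    ∀ {hd : 1 ≤ d + 1} {hL : Odd (ℓ + 1) ∧ 1 < ℓ + 1} {b₀ b₁ : ℝ} (i : KIdx d ℓ hd hL b₀ b₁) (c : ↥(cubes (toKT i).D.toDomains)) (Rr : ℝ) (H : Prop)
      (par : SiteParY 𝔸 i), (∀ z w, par (fun _ _ => 1) z w = 1) →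
      M₀ ≤ ((ℓ : ℝ) + 1) * (toKT i).Mh → N₀ + 1 ≤ (toKT i).R * ((ℓ + 1) * (toKT i).Mh) → T₀ ≤ RM1 i →
    ∀ (α₁ : ℝ), 0 ≤ α₁ → α₁ ≤ a₁ →
    ∀ (A : AfldY 𝔸 i),
      (∀ y x, blkCubeY i c x = y → ‖kFCubeY i c par (fun _ _ => 1) (locCfgY i c (kGeo i).eta A) y x‖ ≤ Cq * α₁ * wK i c y) →
      (∀ x, ‖sFCubeY i c par (fun _ _ => 1) (locCfgY i c (kGeo i).eta A) x‖ ≤ Cq * α₁) →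
      (∀ ν k x, ‖(((geoCK i c).eta : ℂ)⁻¹) • covDstar (shiftY i) (fun _ _ => (1 : 𝔸ˣ)) ν (chartA i (cutFldY i (chiTY i c) A) k) x‖ ≤
        α₁ * ((geoCK i c).len (blkCubeY i c x) ^ 2)⁻¹) →
      (∀ μ ν x, ‖(((geoCK i c).eta : ℂ)⁻¹) • covD (shiftY i) (fun _ _ => (1 : 𝔸ˣ)) μ (chartA i (cutFldY i (chiTY i c) A) ν) x‖ ≤
        α₁ * ((geoCK i c).len (blkCubeY i c x) ^ 2)⁻¹) →
      (∀ μ x, ‖(((geoCK i c).eta : ℂ)⁻¹) • covDstar (shiftY i) (fun _ _ => (1 : 𝔸ˣ)) μ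
          (tauB (shiftY i) (fun _ _ => (1 : 𝔸ˣ)) μ (chartA i (cutFldY i (chiTY i c) A) μ)) x‖ ≤ α₁ * ((geoCK i c).len (blkCubeY i c x) ^ 2)⁻¹) →
      (∀ k x, ‖chartA i (cutFldY i (chiTY i c) A) k x‖ ≤ α₁ * ((geoCK i c).len (blkCubeY i c x))⁻¹) →
      (∀ ν k x, ‖tauB (shiftY i) (fun _ _ => (1 : 𝔸ˣ)) ν (chartA i (cutFldY i (chiTY i c) A) k) x‖ ≤ α₁ * ((geoCK i c).len (blkCubeY i c x))⁻¹) →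
      (∀ (s : BlkCubeY i c) (lam : SiteY i → 𝔸),
        ‖(QpCubeY i c par (locCfgY i c (kGeo i).eta A) lam - QpCubeY i c par (fun _ _ => 1) lam) s‖ ≤ Cq * α₁ * ∑ z, |qpKc i c s z| * ‖lam z‖) →
      (∀ (z : SiteY i) (nu : BlkCubeY i c → 𝔸),
        ‖(QpsCubeY i c par (locCfgY i c (kGeo i).eta A) nu - QpsCubeY i c par (fun _ _ => 1) nu) z‖ ≤ Cq * α₁ * ∑ s, |qpsKc i c z s| * ‖nu s‖) →
      HasMajorant (g := toB6 (geoCK i c) Rr H) (fun q : (Fin (d + 1) × SiteY i) × ι => blkCubeY i c q.1.2)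
        (conjHom b (gradLin (shiftY i) (((geoCK i c).eta : ℂ)⁻¹) (UboxY i (locCfgY i c (kGeo i).eta A))) ∘ₗ
            (conj b (((kGeo i).eta ^ 2) • (GpCubeY i c par (locCfgY i c (kGeo i).eta A)).restrictScalars ℝ) ∘ₗ
              conjHom b ((QpsCubeY i c par (locCfgY i c (kGeo i).eta A)).restrictScalars ℝ) ∘ₗ
              conj b ((((kGeo i).eta ^ 4)⁻¹) • (XinvCubeY i c par (locCfgY i c (kGeo i).eta A)).restrictScalars ℝ) ∘ₗ
              conjHom b ((QpCubeY i c par (locCfgY i c (kGeo i).eta A)).restrictScalars ℝ) ∘ₗ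
              conj b (((kGeo i).eta ^ 2) • (GpCubeY i c par (locCfgY i c (kGeo i).eta A)).restrictScalars ℝ)) ∘ₗ
            conjHom b (divLin (shiftY i) (((geoCK i c).eta : ℂ)⁻¹) (UboxY i (locCfgY i c (kGeo i).eta A))) -
          conjHom b (gradLin (shiftY i) (((geoCK i c).eta : ℂ)⁻¹) (fun _ _ => (1 : 𝔸ˣ))) ∘ₗ
            (GpK b i c par ∘ₗ conjHom b ((QpsCubeY i c par (fun _ _ => 1)).restrictScalars ℝ) ∘ₗ CinvK b i c par ∘ₗ
              conjHom b ((QpCubeY i c par (fun _ _ => 1)).restrictScalars ℝ) ∘ₗ GpK b i c par) ∘ₗ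
            conjHom b (divLin (shiftY i) (((geoCK i c).eta : ℂ)⁻¹) (fun _ _ => (1 : 𝔸ˣ))))
        (fun a a' => K * α₁ * ((geoCK i c).len a ^ 2)⁻¹ * Real.exp (-(δ * (geoCK i c).dist a a'))) := by
  classical
  have hSb : 0 ≤ ∑ j, ‖b j‖ := Finset.sum_nonneg fun j _ => norm_nonneg _
  -- r05's flat Theorem 3.1 (all orientations, p33 F6 §1) and flat Theorem 3.2 (kernel form) for the cube sequence
  obtain ⟨δ₁, C₁, M₁, T₁, N₁', hδ₁, hC₁, h31⟩ := thm31_cube_allOrientations d ℓ hℓ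
  obtain ⟨δ₂, C₂, M₂', hδ₂, hC₂, -, h32⟩ := thm32_cubeW_flat d ℓ hℓ
  -- p33's Theorem 3.4 at the cube for `G′_□` (the word laws)
  obtain ⟨δG, BG, MG, TG, NG, -, -, aG, haG, BB, -, hG⟩ := cor35_Gp_cube b d ℓ hℓ Cq M₂ hCq hM₂ hrepr h1
  -- one rate below both flat rates
  set δ₀ : ℝ := min δ₁ (δ₂ / 2) with hδ₀def
  have hδ₀ : 0 < δ₀ := lt_min hδ₁ (half_pos hδ₂)
  have hδ₀1 : δ₀ ≤ δ₁ := min_le_left _ _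
  have hδ₀2 : δ₀ ≤ δ₂ / 2 := min_le_right _ _
  obtain ⟨dB, h261⟩ := exists_h261_geoCK d ℓ hδ₀
  have hΛf : ∀ α : ℝ, 0 < α → (1 : ℝ) ≤ ((ℓ : ℝ) + 1) ^ 4 := fun α _ =>
    one_le_pow₀ (by linarith [(Nat.cast_nonneg ℓ : (0 : ℝ) ≤ ℓ)])
  set κQ : ℝ := M₂ * (∑ j, ‖b j‖) + 1 with hκQdef
  have hκQ : 0 < κQ := by rw [hκQdef]; nlinarith
  set cF : ℝ := M₂ * (∑ j, ‖b j‖) * Cq + 1 with hcFdef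
  have hcF : 0 < cF := by rw [hcFdef]; nlinarith [mul_nonneg (mul_nonneg hM₂ hSb) hCq]
  -- r06's engine: (3.77) with the printed quantifiers, on a general block carrier
  obtain ⟨aP, haP, K, hK, H34⟩ := exists_threshold_pOne_uniform_blk b (Fin (d + 1)) dB δ₀ κQ C₁ C₂ cF Cq 1 1 M₂ (fun _ => ((ℓ : ℝ) + 1) ^ 4)
    hκQ hC₁ hC₂ hcF hCq zero_le_one hM₂ hδ₀ hΛf hrepr
  refine ⟨1 / 5 * δ₀, max (max M₁ M₂') MG, max (max T₁ (4 * Real.log ((ℓ : ℝ) + 1) / (9 / 5000 * δ₀))) TG,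
    max (max N₁' (N1 d ℓ (9 / 5000 * δ₀))) NG, by positivity, min aG aP, lt_min haG haP, K, hK, ?_⟩
  intro hd hL b₀ b₁ i c Rr H par hpar hM hN hT α₁ hα0 hα1 A hkF hsF h337B h337F h337Bτ hA hAτB hF hFs
  -- thresholds
  have hM1 : M₁ ≤ ((ℓ : ℝ) + 1) * (toKT i).Mh := ((le_max_left _ _).trans (le_max_left _ _)).trans hM
  have hM2 : M₂' ≤ ((ℓ : ℝ) + 1) * (toKT i).Mh := ((le_max_right _ _).trans (le_max_left _ _)).trans hM
  have hMG : MG ≤ ((ℓ : ℝ) + 1) * (toKT i).Mh := (le_max_right _ _).trans hM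
  have hN1 : N₁' + 1 ≤ (toKT i).R * ((ℓ + 1) * (toKT i).Mh) := le_trans (Nat.succ_le_succ ((le_max_left _ _).trans (le_max_left _ _))) hN
  have hN2 : N1 d ℓ (9 / 5000 * δ₀) + 1 ≤ (toKT i).R * ((ℓ + 1) * (toKT i).Mh) :=
    le_trans (Nat.succ_le_succ ((le_max_right _ _).trans (le_max_left _ _))) hN
  have hNG : NG + 1 ≤ (toKT i).R * ((ℓ + 1) * (toKT i).Mh) := le_trans (Nat.succ_le_succ (le_max_right _ _)) hN
  have hT1 : T₁ ≤ RM1 i := ((le_max_left _ _).trans (le_max_left _ _)).trans hT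
  have hT2 : 4 * Real.log ((ℓ : ℝ) + 1) / (9 / 5000 * δ₀) ≤ RM1 i := ((le_max_right _ _).trans (le_max_left _ _)).trans hT
  have hTG : TG ≤ RM1 i := (le_max_right _ _).trans hT
  -- the word `gPrimeExtEnd Gp (conj b V′·Gp)` IS `conj b(η²G′_□(Ṽ_□))` (p21 §1)
  obtain ⟨hw1, hw2, -, -⟩ := hG i c Rr H par hpar hMG hNG hTG α₁ hα0 (hα1.trans (min_le_left _ _)) (chartA i (cutFldY i (chiTY i c) A))
    (kFCubeY i c par (fun _ _ => 1) (locCfgY i c (kGeo i).eta A)) (sFCubeY i c par (fun _ _ => 1) (locCfgY i c (kGeo i).eta A))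
    hkF hsF h337B h337F h337Bτ hA hAτB
  rw [DpK_sub_conj_vPrimeConc] at hw1 hw2
  obtain ⟨-, hW⟩ := eq_conj_GpCubeY_of_laws b i c par _ hw1 hw2
  -- geometry of the cube sequence (p33 5a)
  haveI : Nonempty (geoCK i c).Site := geoCK_site_nonempty i c
  obtain ⟨hdnn, htri, hrefl, hsym⟩ := geoCK_dist_axioms i c Rr H
  obtain ⟨hd₀B, hd₀F, hd₀0⟩ := stencil_geoCK i c
  -- Theorem 3.1 (3.42)₁,₂,₃ for `G′_□(1)` in conj-`b` form at the rate `δ₀`, all orientations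
  obtain ⟨e1, e2, e3, e2', e3'⟩ := h31 i c Rr H hM1 hN1 hT1
  have g342_1 : HasMajorant (g := toB6 (geoCK i c) Rr H) (fun p : SiteY i × ι => blkCubeY i c p.1) (GpK b i c par)
      (fun a a' => C₁ * (geoCK i c).len a ^ 2 * Real.exp (-(δ₀ * (geoCK i c).dist a a'))) :=
    hasMajorant_mono (g := toB6 (geoCK i c) Rr H) _ (h342_1_cube b i c par hpar Rr H (hasMajorant_geomT_of_toB6 i c Rr H e1))
      fun a a' => kernel_rate_mono hdnn hδ₀1 (mul_nonneg hC₁.le (sq_nonneg _)) a a'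
  have g342_2 : ∀ k : Fin (d + 1) ⊕ Fin (d + 1), HasMajorant (g := toB6 (geoCK i c) Rr H) (fun p : SiteY i × ι => blkCubeY i c p.1)
      (conj b (diffLetter (shiftY i) (fun _ _ => (1 : 𝔸ˣ)) ((((geoCK i c).eta : ℂ))⁻¹) k) * GpK b i c par)
      (fun a a' => C₁ * (geoCK i c).len a * Real.exp (-(δ₀ * (geoCK i c).dist a a'))) := by
    rintro (μ | μ)
    · exact hasMajorant_mono (g := toB6 (geoCK i c) Rr H) _ (h342_2_cube_inl b i c par hpar Rr H μ (hasMajorant_geomT_of_toB6 i c Rr H (e2 μ)))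
        fun a a' => kernel_rate_mono hdnn hδ₀1 (mul_nonneg hC₁.le (geoCK_len_pos i c a).le) a a'
    · exact hasMajorant_mono (g := toB6 (geoCK i c) Rr H) _ (h342_2_cube_inr b i c par hpar Rr H μ (e2' μ))
        fun a a' => kernel_rate_mono hdnn hδ₀1 (mul_nonneg hC₁.le (geoCK_len_pos i c a).le) a a'
  have g342_3 : ∀ k : Fin (d + 1) ⊕ Fin (d + 1), HasMajorant (g := toB6 (geoCK i c) Rr H) (fun p : SiteY i × ι => blkCubeY i c p.1)
      (GpK b i c par * conj b (diffLetter (shiftY i) (fun _ _ => (1 : 𝔸ˣ)) ((((geoCK i c).eta : ℂ))⁻¹) k))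
      (fun a a' => C₁ * (geoCK i c).len a * Real.exp (-(δ₀ * (geoCK i c).dist a a'))) := by
    rintro (μ | μ)
    · exact hasMajorant_mono (g := toB6 (geoCK i c) Rr H) _ (h342_3_cube_inl b i c par hpar Rr H μ (e3' μ))
        fun a a' => kernel_rate_mono hdnn hδ₀1 (mul_nonneg hC₁.le (geoCK_len_pos i c a).le) a a'
    · exact hasMajorant_mono (g := toB6 (geoCK i c) Rr H) _ (h342_3_cube_inr b i c par hpar Rr H μ (hasMajorant_geomT_of_toB6 i c Rr H (e3 μ)))
        fun a a' => kernel_rate_mono hdnn hδ₀1 (mul_nonneg hC₁.le (geoCK_len_pos i c a).le) a a'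
  -- the (3.19) letters at `U = 1` (p21 E2-4a), constant `κ_Q`
  have hκle : M₂ * (∑ j, ‖b j‖) ≤ κQ := by rw [hκQdef]; linarith
  have hpar1 : ∀ z w : SiteY i, ‖((par (fun _ _ => 1) z w : 𝔸ˣ) : 𝔸)‖ ≤ 1 ∧ ‖(((par (fun _ _ => 1) z w)⁻¹ : 𝔸ˣ) : 𝔸)‖ ≤ 1 := fun z w => by
    rw [hpar z w, inv_one, Units.val_one]; exact ⟨h1, h1⟩
  have hQc := hasMajorantHom_mono (g := toB6 (geoCK i c) Rr H) _ _
    (hasMajorantHom_conjHom_QpCubeY i c b par (fun _ _ => 1) (Rr := Rr) (Hp := H) hpar1 hM₂ hrepr)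
    (K' := fun a a' : BlkCubeY i c => κQ * (if a = a' then (1 : ℝ) else 0)) fun a a' => by
      split_ifs
      · rw [mul_one]; exact hκle
      · rw [mul_zero]
  have hQcs := hasMajorantHom_mono (g := toB6 (geoCK i c) Rr H) _ _
    (hasMajorantHom_conjHom_QpsCubeY i c b par (fun _ _ => 1) (Rr := Rr) (Hp := H) hpar1 hM₂ hrepr)
    (K' := fun a a' : BlkCubeY i c => κQ * (if a = a' then (1 : ℝ) else 0)) fun a a' => by
      split_ifs
      · rw [mul_one]; exact hκle
      · rw [mul_zero]
  -- Theorem 3.2 at `U = 1` (p21 E2-4b): the law and the (3.48) majorant at the rate `δ₀`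
  have hLinv := hLinv_cube b i c par hpar
  have h348 : HasMajorant (g := toB6 (geoCK i c) Rr H) (fun q : BlkCubeY i c × ι => q.1) (CinvK b i c par)
      (fun a a' => C₂ * (geoCK i c).len a ^ (-(4 : ℝ)) * Real.exp (-(δ₀ * (geoCK i c).dist a a'))) := by
    obtain ⟨-, -, -, hker⟩ := h32 (toKT i).D c hL.1 (oddMh i) (toKT i).hMh (toKT i).hP (toKT i).hP4 (toKT i).hR hM2
    exact hasMajorant_mono (g := toB6 (geoCK i c) Rr H) _ (h348_cube b i c par hpar Rr H (xinvKc_abs_le_of_kernel_bound i c hker))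
      fun a a' => kernel_rate_mono hdnn hδ₀2 (mul_nonneg hC₂.le (Real.rpow_nonneg (geoCK_len_pos i c a).le _)) a a'
  -- the (3.57) letters (p21 E2-4c), constant `c_F·α₁`
  have hcle : M₂ * (∑ j, ‖b j‖) * (Cq * α₁) ≤ cF * α₁ := by
    rw [hcFdef]; nlinarith [mul_nonneg (mul_nonneg hM₂ hSb) hCq]
  have hFc := hasMajorantHom_mono (g := toB6 (geoCK i c) Rr H) _ _
    (hasMajorantHom_conjHom_QpCubeY_sub i c b par (locCfgY i c (kGeo i).eta A) (fun _ _ => 1) (Rr := Rr) (Hp := H) hM₂ hrepr (by positivity) hF)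
    (K' := fun a a' : BlkCubeY i c => cF * α₁ * (if a = a' then (1 : ℝ) else 0)) fun a a' => by
      split_ifs
      · rw [mul_one]; exact hcle
      · rw [mul_zero]
  have hFcs := hasMajorantHom_mono (g := toB6 (geoCK i c) Rr H) _ _
    (hasMajorantHom_conjHom_QpsCubeY_sub i c b par (locCfgY i c (kGeo i).eta A) (fun _ _ => 1) (Rr := Rr) (Hp := H) hM₂ hrepr (by positivity) hFs)
    (K' := fun a a' : BlkCubeY i c => cF * α₁ * (if a = a' then (1 : ℝ) else 0)) fun a a' => by
      split_ifs
      · rw [mul_one]; exact hcle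
      · rw [mul_zero]
  -- the corner section of the block carrier `(BlkCubeY i □ × ι, Prod.fst)`
  have hrep : ∀ p : BlkCubeY i c × ι,
      blkCubeY i c ((fun p : BlkCubeY i c × ι => ((⟨corner (cubeFamY i c).toDomains p.1, corner_mem (cubeFamY i c).toDomains p.1⟩ : SiteY i), p.2)) p).1 = p.1 :=
    fun p => blkCubeY_corner i c p.1
  -- r06's P₁-clause on the block carrier
  obtain ⟨Tinv, hT1, hT2, hTm⟩ := H34 (shiftY i) (fun _ _ => (1 : 𝔸ˣ)) (g := geoCK i c) (Rr := Rr) (H := H) (blkCubeY i c)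
    (kQCubeY i c par (fun _ _ => 1)) (sQCubeY i c par (fun _ _ => 1)) (cfunK i c) (wK i c)
    hdnn htri hrefl hsym (geoCK_len_pos i c) (geoCK_eta_le_len i c) (geoCK_eta_pos i c)
    (fun α hα hα1 => h261 i c Rr H hN2 α hα hα1.le) (hST_geoCK i c hδ₀ hT2)
    (fun _ _ => ⟨h1, by rw [inv_one, Units.val_one]; exact h1⟩) hd₀B hd₀F hd₀0 (wK_nonneg i c) (card_block_mul_wK_le i c)
    (fun y x hx => by rw [← hx]; exact norm_kQCubeY_one_le i c par h1 hpar _ x) (norm_sQCubeY_one_le i c par h1 hpar) (abs_cfunK_le i c)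
    g342_1 g342_2 g342_3 (fun q : BlkCubeY i c × ι => q.1) _ hrep (rep_corner_injective i c) hQc hQcs hLinv h348 α₁ hα0 (hα1.trans (min_le_right _ _))
    (chartA i (cutFldY i (chiTY i c) A))
    (kFCubeY i c par (fun _ _ => 1) (locCfgY i c (kGeo i).eta A)) (sFCubeY i c par (fun _ _ => 1) (locCfgY i c (kGeo i).eta A))
    hkF hsF h337B h337F h337Bτ hA hAτB (conjHom_restrictScalars_eq_add b _ _) (conjHom_restrictScalars_eq_add b _ _) hFc hFcs
  -- identify the engine's inverse `Tinv` with the record's `conj b(η⁻⁴C_□(Ṽ_□))` (p21 §1)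
  rw [hW, conjHom_Qp_conj_sq_Qps_eq] at hT1 hT2
  obtain ⟨-, hTinv⟩ := eq_conj_XinvCubeY_of_laws b i c par _ hT1 hT2
  rw [hW, hTinv, prodCfg_one_chartA_eq_UboxY_locCfgY, pPrime, pOp_sec_eq (rep_corner_injective i c), pOp_sec_eq (rep_corner_injective i c),
    four_words_eq] at hTm
  rw [GpK, CinvK]
  exact hTm

end Main

end Literature.MathematicalPhysics.QuantumFieldTheory.Balaban1983to89.B9Cor35POneAtCubeLetters

end
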